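import Summits.MatrixMultiplication.MatrixMultiplication.Theses.DefinableSTPPDichotomy

/-!
# `HexagonClearanceR` (crux stmt-MatrixMultiplication-17884): `0 < η` and the pairwise clause are
load-bearing

Negative-side lemmas from the standing disprover's crux attack (cdisprove cycle 1, 2026-08-17;
work file `Cruxes/HexagonClearanceR/Disproof.lean` §1–§2, where the variants are the named
`def HexagonClearanceRWithout… : Prop`).  Each theorem below NEGATES the crux
`Summit.MatrixMultiplication.MatrixMultiplication.Theses.DefinableSTPPDichotomy.HexagonClearanceR`
with ONE hypothesis removed — the negated statement is the route decl copied verbatim with the single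
edit named in the docstring, INLINED (no new definition in the tree; witnesses, ring formulas and
their realisation lemmas are local to the proofs) — and proves the negation sorry-free by an explicit
definable family over prime fields `𝔽_p = ZMod p`:

* `hexagonClearanceR_false_without_eta` — the exponent gain `0 < η` in the mass hypothesis is
  load-bearing: at `η = 0` the DILATED POINT family `A_x = {x}, B_x = {2x}, C_x = {4x}` (`x ∈ 𝔽_p`,
  `m = e = 1`, `p ≥ 5`) satisfies every `≥ 2`-equal-label STPP pattern (hexagon relation
  `i + 2j = 3k`), has mass exactly `|F|^m`, and no sub-family exceeds `|F|^m`;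
* `hexagonClearanceR_false_without_pairwise` — the `≥ 2`-equal-label clause is load-bearing: the
  CONSTANT family `{0},{0},{0}` over `I = F²` (`m = 1`) has mass `|F|^{m+1}` while a fully-STPP
  sub-family has at most one label.

Neither refutes the crux: by `¬ HexagonClearanceR → PairwiseCurvedTilingsLC` (Disproof.lean §0) a
refutation is an LC-witness, and none is known.  These lemmas are the kernel-checked record of which
hypotheses keep the cheap (point) families out.  Companion file: `LoadBearingProvisos.lean` (the two
repair provisos are jointly load-bearing).

References: H. Cohn, R. Kleinberg, B. Szegedy, C. Umans, FOCS 2005 (arXiv:math/0511460) Def. 5.1.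
-/

set_option linter.dupNamespace false  -- `Summit.<S>.<S>.…` is the mandated namespace

namespace Summit.MatrixMultiplication.MatrixMultiplication.Theorems.HexagonClearanceR.Negative

open Finset FirstOrder FirstOrder.Language
open Summit.MatrixMultiplication.MatrixMultiplication.Theses.DefinableSTPPDichotomy

/-- Realisation of the ring formula `v₀ = τ` for a term `τ` in the label variable with
`τ.realize = c * x₀`: it cuts out the point block `{(c x₀)}` of `F¹`. [folklore] -/
theorem mem_singleton_iff_realize_equal {F : Type} [Field F] [FirstOrder.Ring.CompatibleRing F]
    (τ : Language.ring.Term ((Fin 1 ⊕ Fin 1) ⊕ Fin 0)) (c : F)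
    (hτ : ∀ (x v : Fin 1 → F) (y : Fin 0 → F), τ.realize (Sum.elim (Sum.elim x v) y) = c * x 0)
    (y : Fin 0 → F) (x v : Fin 1 → F) :
    v ∈ ({fun _ => c * x 0} : Finset (Fin 1 → F)) ↔
      (Term.equal (Term.var (Sum.inl (Sum.inr 0))) τ :
        Language.ring.Formula ((Fin 1 ⊕ Fin 1) ⊕ Fin 0)).Realize (Sum.elim (Sum.elim x v) y) := by
  rw [Finset.mem_singleton]
  simp [Formula.realize_equal, hτ, funext_iff, Fin.forall_fin_one]

/-- **`0 < η` is load-bearing for `HexagonClearanceR`.**  The negated statement is the crux with the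
mass hypothesis taken at `η = 0` (`|F|^m ≤ mass_I`; the binder `η` and `0 < η` removed), all else
verbatim.  Witness: `m = e = 1`, `k = 0`, `φ_I = ⊤`, `φ_A : v₀ = x₀`, `φ_B : v₀ = x₀ + x₀`,
`φ_C : v₀ = (x₀+x₀)+(x₀+x₀)`; `ε := ε₀`; field `ZMod p`, `p ≥ max(q₁,5)` prime.  The DILATED POINT
family `A_x = {x}`, `B_x = {2x}`, `C_x = {4x}` satisfies every `≥ 2`-equal-label pattern (the
hexagon relation is `i + 2j = 3k`, injective in each variable once `2, 3 ≠ 0`), has mass exactly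
`|I| = p = |F|^m` at every exponent, and NO sub-family exceeds `|F|^m` (each block weighs `1`,
`|J| ≤ p`). [folklore] -/
theorem hexagonClearanceR_false_without_eta :
    ¬ (∀ (e m k : ℕ) (φI : Language.ring.Formula (Fin e ⊕ Fin k))
        (φA φB φC : Language.ring.Formula ((Fin e ⊕ Fin m) ⊕ Fin k)),
        ∃ ε₀ : ℝ, 0 < ε₀ ∧ ∀ ε : ℝ, 0 < ε → ε ≤ ε₀ → ∃ q₁ : ℕ,
          ∀ (F : Type) [Field F] [Fintype F] [FirstOrder.Ring.CompatibleRing F], q₁ ≤ ringChar F →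
            ∀ (y : Fin k → F) (I : Finset (Fin e → F)) (A B C : (Fin e → F) → Finset (Fin m → F)),
              (∀ x, x ∈ I ↔ φI.Realize (Sum.elim x y)) →
              (∀ x v, v ∈ A x ↔ φA.Realize (Sum.elim (Sum.elim x v) y)) →
              (∀ x v, v ∈ B x ↔ φB.Realize (Sum.elim (Sum.elim x v) y)) →
              (∀ x v, v ∈ C x ↔ φC.Realize (Sum.elim (Sum.elim x v) y)) →
              (∀ i ∈ I, ∀ j ∈ I, ∀ k ∈ I, (i = j ∨ j = k ∨ k = i) →
                ∀ s ∈ A k, ∀ s' ∈ A i, ∀ t ∈ B i, ∀ t' ∈ B j, ∀ u ∈ C j, ∀ u' ∈ C k,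
                  (s' - s) + (t' - t) + (u' - u) = 0 → i = j ∧ j = k ∧ s = s' ∧ t = t' ∧ u = u') →
              (Fintype.card F : ℝ) ^ (m : ℝ) ≤
                ∑ x ∈ I, (((A x).card * (B x).card * (C x).card : ℕ) : ℝ) ^ ((2 + ε) / 3) →
              ∃ J : Finset (Fin e → F), J ⊆ I ∧
                (∀ i ∈ J, ∀ j ∈ J, ∀ k ∈ J, ∀ s ∈ A k, ∀ s' ∈ A i, ∀ t ∈ B i, ∀ t' ∈ B j,
                  ∀ u ∈ C j, ∀ u' ∈ C k, (s' - s) + (t' - t) + (u' - u) = 0 →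
                    i = j ∧ j = k ∧ s = s' ∧ t = t' ∧ u = u') ∧
                (Fintype.card F : ℝ) ^ (m : ℝ) <
                  ∑ x ∈ J, (((A x).card * (B x).card * (C x).card : ℕ) : ℝ) ^ ((2 + ε) / 3)) := by
  intro H
  classical
  -- the label variable `x₀` as a ring term, and the three formulas `v₀ = x₀`, `v₀ = 2x₀`, `v₀ = 4x₀`
  let X : Language.ring.Term ((Fin 1 ⊕ Fin 1) ⊕ Fin 0) := Term.var (Sum.inl (Sum.inl 0))
  let ψ : Language.ring.Term ((Fin 1 ⊕ Fin 1) ⊕ Fin 0) → Language.ring.Formula ((Fin 1 ⊕ Fin 1) ⊕ Fin 0) :=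
    fun τ => Term.equal (Term.var (Sum.inl (Sum.inr 0))) τ
  obtain ⟨ε₀, hε₀, H1⟩ := H 1 1 0 ⊤ (ψ X) (ψ (X + X)) (ψ ((X + X) + (X + X)))
  obtain ⟨q₁, H2⟩ := H1 ε₀ hε₀ le_rfl
  obtain ⟨p, hpge, hp⟩ := Nat.exists_infinite_primes (max q₁ 5)
  haveI : Fact p.Prime := ⟨hp⟩
  let F := ZMod p
  letI : FirstOrder.Ring.CompatibleRing F := FirstOrder.Ring.compatibleRingOfRing F
  have hchar : q₁ ≤ ringChar F := by
    rw [ZMod.ringChar_zmod_n]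
    exact (le_max_left _ _).trans hpge
  have hp5 : 5 ≤ p := (le_max_right _ _).trans hpge
  have hne : ∀ n : ℕ, 0 < n → n < 5 → ((n : ℕ) : F) ≠ 0 := by
    intro n hn0 hn5 h
    have hdvd : p ∣ n := (ZMod.natCast_eq_zero_iff n p).1 h
    have := Nat.le_of_dvd hn0 hdvd
    omega
  have h2 : (2 : F) ≠ 0 := by exact_mod_cast hne 2 (by norm_num) (by norm_num)
  have h3 : (3 : F) ≠ 0 := by exact_mod_cast hne 3 (by norm_num) (by norm_num)
  -- the dilated point family and its realisation lemmas
  let P : F → (Fin 1 → F) → Finset (Fin 1 → F) := fun c x => {fun _ => c * x 0}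
  have hX : ∀ (x v : Fin 1 → F) (y : Fin 0 → F),
      X.realize (Sum.elim (Sum.elim x v) y) = 1 * x 0 := by
    intro x v y; simp [X]
  have hX2 : ∀ (x v : Fin 1 → F) (y : Fin 0 → F),
      (X + X).realize (Sum.elim (Sum.elim x v) y) = 2 * x 0 := by
    intro x v y; simp [X, two_mul]
  have hX4 : ∀ (x v : Fin 1 → F) (y : Fin 0 → F),
      ((X + X) + (X + X)).realize (Sum.elim (Sum.elim x v) y) = 4 * x 0 := by
    intro x v y
    simp only [FirstOrder.Ring.realize_add, Term.realize_var, Sum.elim_inl, X]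
    ring
  have key := H2 F hchar ![] univ (P 1) (P 2) (P 4) (fun x => by simp)
    (fun x v => mem_singleton_iff_realize_equal X 1 hX ![] x v)
    (fun x v => mem_singleton_iff_realize_equal (X + X) 2 hX2 ![] x v)
    (fun x v => mem_singleton_iff_realize_equal ((X + X) + (X + X)) 4 hX4 ![] x v)
  obtain ⟨J, -, -, hJmass⟩ := key
    (by
      intro i _ j _ k _ hcase s hs s' hs' t ht t' ht' u hu u' hu' hsum
      simp only [P, Finset.mem_singleton] at hs hs' ht ht' hu hu'
      subst hs hs' ht ht' hu hu'
      have e0 := congrFun hsum 0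
      simp only [Pi.add_apply, Pi.sub_apply, Pi.zero_apply, one_mul] at e0
      -- `e0 : i 0 - k 0 + (2 * j 0 - 2 * i 0) + (4 * k 0 - 4 * j 0) = 0`
      have hijk : i 0 = j 0 ∧ j 0 = k 0 := by
        rcases hcase with h | h | h
        · have h0 := congrFun h 0
          have h3k : (3 : F) * (k 0 - i 0) = 0 := by linear_combination e0 - 2 * h0
          have hki : k 0 - i 0 = 0 := (mul_eq_zero.1 h3k).resolve_left h3
          exact ⟨h0, by linear_combination -h0 - hki⟩
        · have h0 := congrFun h 0
          exact ⟨by linear_combination -e0 - 3 * h0, h0⟩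
        · have h0 := congrFun h 0
          have h2k : (2 : F) * (i 0 - j 0) = 0 := by linear_combination e0 - 3 * h0
          have hij : i 0 - j 0 = 0 := (mul_eq_zero.1 h2k).resolve_left h2
          exact ⟨by linear_combination hij, by linear_combination -hij - h0⟩
      have hij : i = j := funext fun l => by rw [Fin.fin_one_eq_zero l]; exact hijk.1
      have hjk : j = k := funext fun l => by rw [Fin.fin_one_eq_zero l]; exact hijk.2
      subst hij hjk
      exact ⟨rfl, rfl, rfl, rfl, rfl⟩)
    (by
      simp only [P, card_singleton, mul_one, Nat.cast_one, Real.one_rpow, sum_const, card_univ,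
        Fintype.card_fun, Fintype.card_fin, pow_one, nsmul_eq_mul, Real.rpow_one]
      rfl)
  -- the mass of `J` is `|J| ≤ p = |F|^1`
  simp only [P, card_singleton, mul_one, Nat.cast_one, Real.one_rpow, sum_const, nsmul_eq_mul,
    Real.rpow_one] at hJmass
  have hJ : (J.card : ℝ) ≤ Fintype.card F := by
    have h := Finset.card_le_univ J
    rw [Fintype.card_fun, Fintype.card_fin, pow_one] at h
    exact_mod_cast h
  linarith

/-- **The pairwise (`≥ 2`-equal-label) clause is load-bearing for `HexagonClearanceR`.**  The negated
statement is the crux with that hypothesis DROPPED, all else verbatim.  Witness: `e = 2`, `m = 1`,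
`k = 0`, `φ_I = ⊤`, `φ_A = φ_B = φ_C : v₀ = 0`; `ε := ε₀`, `η := 1`; field `ZMod p`, `p ≥ max(q₁,2)`
prime.  The CONSTANT family `A_x = B_x = C_x = {0}` (`x ∈ I = F²`) has mass `|F|² = |F|^{m+1}` at
every exponent, while a fully-STPP sub-family has at most ONE label (two labels `i ≠ k` violate the
clause at `j = i` with all six elements `0`), so its mass is `≤ 1 < |F|`. [folklore] -/
theorem hexagonClearanceR_false_without_pairwise :
    ¬ (∀ (e m k : ℕ) (φI : Language.ring.Formula (Fin e ⊕ Fin k))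
        (φA φB φC : Language.ring.Formula ((Fin e ⊕ Fin m) ⊕ Fin k)),
        ∃ ε₀ : ℝ, 0 < ε₀ ∧ ∀ ε η : ℝ, 0 < ε → ε ≤ ε₀ → 0 < η → ∃ q₁ : ℕ,
          ∀ (F : Type) [Field F] [Fintype F] [FirstOrder.Ring.CompatibleRing F], q₁ ≤ ringChar F →
            ∀ (y : Fin k → F) (I : Finset (Fin e → F)) (A B C : (Fin e → F) → Finset (Fin m → F)),
              (∀ x, x ∈ I ↔ φI.Realize (Sum.elim x y)) →
              (∀ x v, v ∈ A x ↔ φA.Realize (Sum.elim (Sum.elim x v) y)) →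
              (∀ x v, v ∈ B x ↔ φB.Realize (Sum.elim (Sum.elim x v) y)) →
              (∀ x v, v ∈ C x ↔ φC.Realize (Sum.elim (Sum.elim x v) y)) →
              (Fintype.card F : ℝ) ^ ((m : ℝ) + η) ≤
                ∑ x ∈ I, (((A x).card * (B x).card * (C x).card : ℕ) : ℝ) ^ ((2 + ε) / 3) →
              ∃ J : Finset (Fin e → F), J ⊆ I ∧
                (∀ i ∈ J, ∀ j ∈ J, ∀ k ∈ J, ∀ s ∈ A k, ∀ s' ∈ A i, ∀ t ∈ B i, ∀ t' ∈ B j,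
                  ∀ u ∈ C j, ∀ u' ∈ C k, (s' - s) + (t' - t) + (u' - u) = 0 →
                    i = j ∧ j = k ∧ s = s' ∧ t = t' ∧ u = u') ∧
                (Fintype.card F : ℝ) ^ (m : ℝ) <
                  ∑ x ∈ J, (((A x).card * (B x).card * (C x).card : ℕ) : ℝ) ^ ((2 + ε) / 3)) := by
  intro H
  classical
  -- the formula `v₀ = 0` (label `x : Fin 2`, vector `v : Fin 1`, no parameters)
  let ψ0 : Language.ring.Formula ((Fin 2 ⊕ Fin 1) ⊕ Fin 0) :=
    Term.equal (Term.var (Sum.inl (Sum.inr 0))) 0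
  obtain ⟨ε₀, hε₀, H1⟩ := H 2 1 0 ⊤ ψ0 ψ0 ψ0
  obtain ⟨q₁, H2⟩ := H1 ε₀ 1 hε₀ le_rfl one_pos
  obtain ⟨p, hpge, hp⟩ := Nat.exists_infinite_primes (max q₁ 2)
  haveI : Fact p.Prime := ⟨hp⟩
  let F := ZMod p
  letI : FirstOrder.Ring.CompatibleRing F := FirstOrder.Ring.compatibleRingOfRing F
  have hchar : q₁ ≤ ringChar F := by
    rw [ZMod.ringChar_zmod_n]
    exact (le_max_left _ _).trans hpge
  have hQ2 : (2 : ℝ) ≤ Fintype.card F := by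
    have h : 2 ≤ Fintype.card F := by rw [ZMod.card]; exact hp.two_le
    exact_mod_cast h
  -- the constant family and its realisation lemma
  let Z : (Fin 2 → F) → Finset (Fin 1 → F) := fun _ => {0}
  have hZ : ∀ (x : Fin 2 → F) (v : Fin 1 → F), v ∈ Z x ↔ ψ0.Realize (Sum.elim (Sum.elim x v) ![]) := by
    intro x v
    simp only [Z, Finset.mem_singleton]
    simp [ψ0, Formula.realize_equal, funext_iff, Fin.forall_fin_one]
  have key := H2 F hchar ![] univ Z Z Z (fun x => by simp) hZ hZ hZ
  obtain ⟨J, -, hJclean, hJmass⟩ := key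
    (by
      simp only [Z, card_singleton, mul_one, Nat.cast_one, Real.one_rpow, sum_const,
        card_univ, Fintype.card_fun, Fintype.card_fin, nsmul_eq_mul, Nat.cast_pow]
      rw [show (1 : ℝ) + 1 = ((2 : ℕ) : ℝ) by norm_num, Real.rpow_natCast])
  -- a clean sub-family has at most one label
  have hJ1 : J.card ≤ 1 := by
    refine Finset.card_le_one.2 fun a ha b hb => ?_
    have h := hJclean a ha a ha b hb 0 (by simp [Z]) 0 (by simp [Z]) 0 (by simp [Z])
      0 (by simp [Z]) 0 (by simp [Z]) 0 (by simp [Z]) (by simp)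
    exact h.2.1
  simp only [Z, card_singleton, mul_one, Nat.cast_one, Real.one_rpow, sum_const,
    nsmul_eq_mul, Real.rpow_one] at hJmass
  have hJ1' : (J.card : ℝ) ≤ 1 := by exact_mod_cast hJ1
  linarith

end Summit.MatrixMultiplication.MatrixMultiplication.Theorems.HexagonClearanceR.Negative
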